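import Literature.AnabelianGeometry.EtaleTheta.Discharge.Sec5TransportsHYddOfConnectedTemperoid
import Literature.AnabelianGeometry.EtaleTheta.Discharge.Sec5SectionPairOfStrv

/-!
# [EtTh] Thm. 5.10 (ii) / Thm. 5.7 at the genuine §5 data: the five transport binders with NO σ-side, shadow or Galois input left (pp. 328–334 / PDF pp. 102–108)

Mochizuki, *The étale theta function …*, Publ. RIMS **45** (2009), proof of Thm. 5.6/5.7 p.328–329 (PDF pp.102–103), proof of
Thm. 5.10 (ii) p.334 (PDF p.108) [cite: MochizukiEtTh2009, Thm 5.10 (ii) p.334 (PDF p.108)]; [FrdI] Prop. 5.6 p.105.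

PROOF-ONLY (no definitions, no new named facts).  abc-iut cell, layer L2 (prover abc-iut-w5-d245): the capstone
`exists_unit_transports_hYdd_ofConnectedTemperoidData` (p436418) with its section-pair input `(φ, hφ, hc)` DISCHARGED by
abc-iut-w5-d034's `ThetaFrobenioid.exists_sectionPair_strvOfBiKummerData` (p436647: the constructed `s^trv_N = strvOfBiKummerData`
arises from a base-Frobenius pair of `A_N`).  RESULT `exists_unit_transports_hYdd_ofConnectedTemperoidData_strv`: at
`𝔉 := ofConnectedTemperoidData …` over `B^temp(Π^tp_X)⁰`, from the model hypotheses (base of FSM-type, slim, `Φ` non-dilating,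
`C` not group-like), `Ψ` with `α, β`, Prop. 5.3 (vi) at `A_N` (`e = 1` form) and Prop. 2.4 (∀γ-stability of `Π^tp_Ÿ`) ALONE:
∃ ONE base shadow `θ`, ONE unit `e`, `D_c, D_p` with `hT ∧ hT′ ∧ hu ∧ hstrv ∧ hYdd` — the five transport binders of
`cyclotomicRigidityPreserved_ofBiKummerData` (p421202) for abc-iut-L2-d4's Thm. 5.7 wiring (`hdesc`, level 1) and the K4 knit.
Nothing asserts that the §5 data exist for an actual curve; no side is taken on [IUTchIII] Cor. 3.12.
-/

noncomputable section

namespace Literature.AnabelianGeometry.EtaleTheta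

open CategoryTheory Opposite Literature.AlgebraicGeometry.Frobenioids Literature.AnabelianGeometry.SemiGraphs
  Literature.AnabelianGeometry.SemiGraphs.GaloisObjects FrobenioidCyclotomicRigidity

namespace ThetaFrobenioid

universe u₀ v₀ w

section ConnectedTemperoidData

variable {K : Type u₀} [Field K] {X : SemiGraphs.TemperedArithmeticGroup.{u₀} K} {D₀ : Type u₀} [Category.{v₀} D₀]
  {V : FrdIMonoidStub.{w}} {T₀ : RealifiedDivisorMonoids (D₀ := D₀) V}
  {VD : FrdICatStub.{u₀ + 1, u₀, w} (ConnectedPart (BTemp X.Pi))}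
  {tf : TemperedFrobenioid T₀ (ConnectedPart (BTemp X.Pi)) VD} {hZ : tf.monoidType = MonoidType.Z}
  {hP : ∀ A : (ConnectedPart (BTemp X.Pi))ᵒᵖ, IsPerfect (tf.Φ.carrier A)}
  {NH : Subgroup (Field.absoluteGaloisGroup K) → tf.category → ℕ+ → Prop} {A₀ : tf.category}
  {hA₀ : PreFrobenioid.IsFrobeniusTrivial tf.toElem A₀} {hA₀' : SemiGraphs.IsGaloisObj A₀.base.obj}
  {lv N : ℕ+} {T : ThetaEnvData.{max u₀ w} N}
  {pullFrac : ∀ {A A' : (BiKummerSetting.mkOfConnectedTemperoid X tf hZ hP NH A₀ hA₀ hA₀').C} (_ : A' ⟶ A),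
    (BiKummerSetting.mkOfConnectedTemperoid X tf hZ hP NH A₀ hA₀ hA₀').biratUnits A →
      (BiKummerSetting.mkOfConnectedTemperoid X tf hZ hP NH A₀ hA₀ hA₀').biratUnits A'}
  {θ : (BiKummerSetting.mkOfConnectedTemperoid X tf hZ hP NH A₀ hA₀ hA₀').biratUnits
    (BiKummerSetting.mkOfConnectedTemperoid X tf hZ hP NH A₀ hA₀ hA₀').Aodot}
  {Bl : (BiKummerSetting.mkOfConnectedTemperoid X tf hZ hP NH A₀ hA₀ hA₀').C}
  {Pl : (BiKummerSetting.mkOfConnectedTemperoid X tf hZ hP NH A₀ hA₀ hA₀').FractionPair θ Bl}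
  {Rl : (BiKummerSetting.mkOfConnectedTemperoid X tf hZ hP NH A₀ hA₀ hA₀').NthRoot θ Pl lv pullFrac}
  (h : ModelFrobenioid.Hypotheses tf.divisorMonoid tf.ratFnFunctor)
  (Q : FrobenioidTheta.ThetaSubquotientStub.{w} (ConnectedPart (BTemp X.Pi))) (odd_l : Odd (lv : ℕ))
  (R : (BiKummerSetting.mkOfConnectedTemperoid X tf hZ hP NH A₀ hA₀ hA₀').NthRoot Rl.root Rl.pair N pullFrac)
  (ιX : T.PiX ≃ₜ* X.Pi) (K' : Type w) [Field K'] (constEmb : K'ˣ →* tf.biratUnitsModel R.BN)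
  (constEmb_injective : Function.Injective constEmb)
  (hinvc : ∀ g : Aut R.AN.base,
    pull tf.divisorMonoid g.hom (ModelFrobenioid.div R.pair.num) = ModelFrobenioid.div R.pair.num)
  (hinvp : ∀ y : T.PiX, y ∈ T.PiYdd →
    pull tf.divisorMonoid ((BiKummerSetting.mkOfConnectedTemperoid X tf hZ hP NH A₀ hA₀ hA₀').galoisSurj R.AN.base
      R.αData.isGalois (ιX y)).hom (ModelFrobenioid.div R.pair.den) = ModelFrobenioid.div R.pair.den)

/-- **Thm. 5.10 (ii) / Thm. 5.7 at the genuine §5 data, σ-side PRODUCED**: the five transport binders `hT`, `hT′`, `hu`,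
`hstrv`, `hYdd` with ONE produced base shadow and ONE unit, from the model hypotheses, `Ψ, α, β`, Prop. 5.3 (vi) at `A_N` and
Prop. 2.4 only (the section pair of `s^trv_N` is abc-iut-w5-d034's theorem `exists_sectionPair_strvOfBiKummerData`).
[cite: MochizukiEtTh2009, Thm 5.10 (ii) p.334 (PDF p.108)] -/
theorem exists_unit_transports_hYdd_ofConnectedTemperoidData_strv (hD : IsOfFSMType (ConnectedPart (BTemp X.Pi)))
    (hslim : IsSlim (ConnectedPart (BTemp X.Pi))) (hnd : IsNonDilatingOn tf.divisorMonoid)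
    (hN : ∃ A : (BiKummerSetting.mkOfConnectedTemperoid X tf hZ hP NH A₀ hA₀ hA₀').C,
      ¬ (PreFrobenioidData.ofModel tf.divisorMonoid tf.ratFnFunctor tf.divBNatTrans).IsGroupLikeObj A)
    (Ψ : (BiKummerSetting.mkOfConnectedTemperoid X tf hZ hP NH A₀ hA₀ hA₀').C ≌
      (BiKummerSetting.mkOfConnectedTemperoid X tf hZ hP NH A₀ hA₀ hA₀').C)
    (α : Ψ.functor.obj (ofConnectedTemperoidData h Q odd_l R ιX K' constEmb constEmb_injective hinvc hinvp).AN ≅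
      (ofConnectedTemperoidData h Q odd_l R ιX K' constEmb constEmb_injective hinvc hinvp).AN)
    (β : Ψ.functor.obj (ofConnectedTemperoidData h Q odd_l R ιX K' constEmb constEmb_injective hinvc hinvp).BN ≅
      (ofConnectedTemperoidData h Q odd_l R ιX K' constEmb constEmb_injective hinvc hinvp).BN)
    (hdivcap₁ : (ofConnectedTemperoidData h Q odd_l R ιX K' constEmb constEmb_injective hinvc hinvp).pre.div
        (α.inv ≫ Ψ.functor.map (ofConnectedTemperoidData h Q odd_l R ιX K' constEmb constEmb_injective hinvc hinvp).sCap ≫ β.hom) =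
      (ofConnectedTemperoidData h Q odd_l R ιX K' constEmb constEmb_injective hinvc hinvp).pre.div
        (ofConnectedTemperoidData h Q odd_l R ιX K' constEmb constEmb_injective hinvc hinvp).sCap)
    (hdivcup₁ : (ofConnectedTemperoidData h Q odd_l R ιX K' constEmb constEmb_injective hinvc hinvp).pre.div
        (α.inv ≫ Ψ.functor.map (ofConnectedTemperoidData h Q odd_l R ιX K' constEmb constEmb_injective hinvc hinvp).sCup ≫ β.hom) =
      (ofConnectedTemperoidData h Q odd_l R ιX K' constEmb constEmb_injective hinvc hinvp).pre.div
        (ofConnectedTemperoidData h Q odd_l R ιX K' constEmb constEmb_injective hinvc hinvp).sCup)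
    (hP24 : ∀ γ : T.PiX ≃ₜ* T.PiX, T.PiYdd.map γ.toMulEquiv.toMonoidHom = T.PiYdd) :
    ∃ θA : Aut R.AN.base ≃* Aut R.AN.base,
      ∃ e ∈ (ofConnectedTemperoidData h Q odd_l R ιX K' constEmb constEmb_injective hinvc hinvp).units
          (ofConnectedTemperoidData h Q odd_l R ιX K' constEmb constEmb_injective hinvc hinvp).AN,
        ∃ Dc Dp : Aut (ofConnectedTemperoidData h Q odd_l R ιX K' constEmb constEmb_injective hinvc hinvp).BN,
          α.inv ≫ Ψ.functor.map (ofConnectedTemperoidData h Q odd_l R ιX K' constEmb constEmb_injective hinvc hinvp).sCap ≫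
              (β ≪≫ Dc.symm).hom =
            e.hom ≫ (ofConnectedTemperoidData h Q odd_l R ιX K' constEmb constEmb_injective hinvc hinvp).sCap ≫
              (1 : Aut (ofConnectedTemperoidData h Q odd_l R ιX K' constEmb constEmb_injective hinvc hinvp).BN).hom ∧
          α.inv ≫ Ψ.functor.map (ofConnectedTemperoidData h Q odd_l R ιX K' constEmb constEmb_injective hinvc hinvp).sCup ≫
              (β ≪≫ Dc.symm).hom =
            e.hom ≫ (ofConnectedTemperoidData h Q odd_l R ιX K' constEmb constEmb_injective hinvc hinvp).sCup ≫ Dp.hom ∧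
          Dp ∈ (ofConnectedTemperoidData h Q odd_l R ιX K' constEmb constEmb_injective hinvc hinvp).units
            (ofConnectedTemperoidData h Q odd_l R ιX K' constEmb constEmb_injective hinvc hinvp).BN ∧
          (ofConnectedTemperoidData h Q odd_l R ιX K' constEmb constEmb_injective hinvc hinvp).StrvTransport Ψ α e
            (((ofConnectedTemperoidData h Q odd_l R ιX K' constEmb constEmb_injective hinvc hinvp).autBaseIsoAB.symm.trans θA).trans
              (ofConnectedTemperoidData h Q odd_l R ιX K' constEmb constEmb_injective hinvc hinvp).autBaseIsoAB) ∧
          (ofConnectedTemperoidData h Q odd_l R ιX K' constEmb constEmb_injective hinvc hinvp).HB.map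
              ((((ofConnectedTemperoidData h Q odd_l R ιX K' constEmb constEmb_injective hinvc hinvp).autBaseIsoAB.symm.trans
                  θA).trans
                (ofConnectedTemperoidData h Q odd_l R ιX K' constEmb constEmb_injective hinvc hinvp).autBaseIsoAB).toMonoidHom) =
            (ofConnectedTemperoidData h Q odd_l R ιX K' constEmb constEmb_injective hinvc hinvp).HB := by
  obtain ⟨φ, hφ, hc⟩ := exists_sectionPair_strvOfBiKummerData h R
  exact exists_unit_transports_hYdd_ofConnectedTemperoidData h Q odd_l R ιX K' constEmb constEmb_injective hinvc hinvp hD hslim hnd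
    hN φ hφ hc Ψ α β hdivcap₁ hdivcup₁ hP24

end ConnectedTemperoidData

end ThetaFrobenioid

end Literature.AnabelianGeometry.EtaleTheta

end
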